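import Summits.ABC.IUTFork.Cor312CapstoneWitnessB
import HarnessLib

/-!
# TEAM B capstone witness, CONTENTFUL upgrade, part A: non-degenerate shells, typed Theorem 3.11 TRUE

Record-only file (D-0012) of the abc-iut cell (Cor. 3.12 STRATEGY TEAM B «estimate / log-Kummer»,
HUMAN RULING D-0067 (3), seat abc-iut-c312-11 = B1; NV-parity with Team A's
`Cor312TeamAGapWitnessNV` p414526 against the w5-d189-style degeneracy census); TAKES NO SIDE. The
capstone-premise witness `Cor312CapstoneWitness`/`B` (p416604/p416831) instantiates the TEAM B
capstone's twelve Haar side conditions over DEGENERATE situation data (empty splitting monoids,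
`shellPk = univ`, only the identity in `Ism`). THIS file builds a CONTENTFUL instantiation — the
companion `Cor312CapstoneWitnessNVB` discharges the twelve conditions and the negations over it:

* `nvShells` — `Ism = {id, −id}`: the (Ind2) family `negFamily` ACTS NON-TRIVIALLY on the packets
  (`negFamily_ne_id`: at the label `0` it negates the nonzero tensor `nvUnit`);
* `nvData` — PROPER integral structures `shellPk = {0}` (nonempty, admissible of volume `1/4`, not
  everything: `nv_shellPk_proper`); NONEMPTY splitting monoids with a NONZERO member
  (`nv_psi_nonempty`; `PsiInSubPackets` via `nv_mem_subPacket` — the one-place sub-packets are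
  everything); admissibility/log-volume READ OFF part A's honest `ZMod 4` Haar container
  (`NVAdm`/`nvVol` through the comparison `nvMap`, so the capstone's container readings hold by
  `rfl`/`Iff.rfl`);
* `nvFull_statement` — the typed **Theorem 3.11 (i) ∧ (ii) ∧ (iii) holds in full** at the contentful
  witness.

HONEST SCOPE: interface-level, toy carriers (`l⋆ = 2`, one place, `ℚ`-line packets); the glue fields
remain free. Sources: [IUTchIII] pp. 153–158, 173–175; [AbsTopIII] Prop. 5.7 (i).
[claim: Mochizuki2012, status: disputed]
[cite: MochizukiAbsTopIII2015, Prop. 5.7 (i) pp. 137–138] [cite: ScholzeStix2018, §2.2 pp. 9–10]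
Deliberately NOT here: the setting, the capstone instantiation, the failures of the residual input
(part NVB), any real-setting discharge, any judgement on Cor. 3.12 or its gap rows.
-/

noncomputable section

namespace Summit.ABC

namespace IUTFork

namespace Cor312Vol

namespace CapstoneWitness

open Thm311 Cor312 Cor312.Checks Cor312Vol.GapWitness Literature.IUT.LogVolume
  Literature.IUT.LogThetaLattice MeasureTheory Set
open scoped ENNReal Pointwise

/-! ## 1. Contentful log-shells: `Ism = {id, −id}` -/

/-- The CONTENTFUL toy log-shells: the same `ℚ`-line carriers as `Cor312.Checks.toyShells`, but
`Ism = {id, −id}` — the (Ind2) indeterminacies genuinely move the packets. [folklore] -/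
def nvShells : LogShells toyIndex where
  carrier := fun _ => ℚ
  shell := fun _ => Set.univ
  stripAut := fun _ => {LinearEquiv.refl ℚ ℚ}
  ism := fun _ => {LinearEquiv.refl ℚ ℚ, LinearEquiv.neg ℚ}
  one_mem_stripAut := fun _ => rfl
  one_mem_ism := fun _ => Set.mem_insert _ _

/-- The contentful packets are `ℚ`-lines (as in `GapWitness.packetEquiv`). [folklore] -/
def nvPacketEquiv (j : toyIndex.Label) (vQ : toyIndex.VQ) : nvShells.Packet j vQ ≃ₗ[ℚ] ℚ :=
  haveI := fibreUnique vQ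
  (PiTensorProduct.congr fun _ : toyIndex.Caps j =>
      LinearEquiv.funUnique (toyIndex.Fibre vQ) ℚ ℚ).trans
    (PiTensorProduct.constantBaseRingEquiv (toyIndex.Caps j) ℚ).toLinearEquiv

/-- The contentful packets are nontrivial. [folklore] -/
theorem nv_packet_nontrivial (j : toyIndex.Label) (vQ : toyIndex.VQ) :
    Nontrivial (nvShells.Packet j vQ) :=
  (nvPacketEquiv j vQ).symm.injective.nontrivial

/-- The whole contentful packet is not contained in `{0}`. [folklore] -/
theorem nv_univ_not_subset_zero (j : toyIndex.Label) (vQ : toyIndex.VQ) :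
    ¬ (Set.univ : Set (nvShells.Packet j vQ)) ⊆ {0} := by
  haveI := nv_packet_nontrivial j vQ
  obtain ⟨x, hx⟩ := exists_ne (0 : nvShells.Packet j vQ)
  exact fun h => hx (h (Set.mem_univ x))

/-- The (Ind2) family acting by `−id` on every summand of every factor. [folklore] -/
def negFamily : nvShells.PacketAut := fun j vQ =>
  nvShells.factorwise j vQ fun _ => nvShells.summandwise vQ fun _ => LinearEquiv.neg ℚ

/-- `negFamily` IS an (Ind2) family of the contentful shells. [folklore] -/
theorem negFamily_mem_Ind2Family : negFamily ∈ nvShells.Ind2Family := fun _ _ =>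
  ⟨fun _ _ => LinearEquiv.neg ℚ, fun _ _ => Set.mem_insert_of_mem _ rfl, rfl⟩

/-- A nonzero pure tensor: the `1 ⊗ ⋯ ⊗ 1`-tensor of the contentful packet. [folklore] -/
def nvUnit (j : toyIndex.Label) (vQ : toyIndex.VQ) : nvShells.Packet j vQ :=
  nvShells.tprod j vQ fun _ => fun _ => (1 : ℚ)

/-- The `ℚ`-line coordinate of `nvUnit` is `1`. [folklore] -/
theorem nvPacketEquiv_nvUnit (j : toyIndex.Label) (vQ : toyIndex.VQ) :
    nvPacketEquiv j vQ (nvUnit j vQ) = 1 := by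
  haveI := fibreUnique vQ
  show ((PiTensorProduct.constantBaseRingEquiv (toyIndex.Caps j) ℚ).toLinearEquiv)
      ((PiTensorProduct.congr fun _ : toyIndex.Caps j =>
        LinearEquiv.funUnique (toyIndex.Fibre vQ) ℚ ℚ)
          (PiTensorProduct.tprod ℚ fun _ => fun _ => (1 : ℚ))) = 1
  rw [PiTensorProduct.congr_tprod]
  have h : ((PiTensorProduct.constantBaseRingEquiv (toyIndex.Caps j) ℚ).toLinearEquiv)
      (PiTensorProduct.tprod ℚ fun _ =>
        (LinearEquiv.funUnique (toyIndex.Fibre vQ) ℚ ℚ) fun _ => (1 : ℚ)) =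
      ∏ _i : toyIndex.Caps j,
        ((LinearEquiv.funUnique (toyIndex.Fibre vQ) ℚ ℚ) fun _ => (1 : ℚ)) :=
    PiTensorProduct.constantBaseRingEquiv_tprod _
  rw [h]
  have h1 : ((LinearEquiv.funUnique (toyIndex.Fibre vQ) ℚ ℚ) fun _ => (1 : ℚ)) = 1 := rfl
  rw [h1, Finset.prod_const_one]

/-- `nvUnit ≠ 0`. [folklore] -/
theorem nvUnit_ne_zero (j : toyIndex.Label) (vQ : toyIndex.VQ) : nvUnit j vQ ≠ 0 := by
  intro h
  have h1 := nvPacketEquiv_nvUnit j vQ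
  rw [h, map_zero] at h1
  exact one_ne_zero h1.symm

/-- `negFamily` on pure tensors: `Φ(x₀ ⊗ ⋯ ⊗ x_j) = (−1)^{j+1}·(x₀ ⊗ ⋯ ⊗ x_j)`. [folklore] -/
theorem negFamily_tprod (j : toyIndex.Label) (vQ : toyIndex.VQ)
    (x : toyIndex.Caps j → nvShells.Packet1 vQ) :
    negFamily j vQ (nvShells.tprod j vQ x) =
      ((-1 : ℚ) ^ ((j : ℕ) + 1)) • nvShells.tprod j vQ x := by
  unfold negFamily
  rw [nvShells.factorwise_summandwise_tprod j vQ (fun _ _ => LinearEquiv.neg ℚ) x]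
  have h1 : (fun i => fun v => (LinearEquiv.neg ℚ) (x i v)) =
      fun i => (-1 : ℚ) • x i := by
    funext i v
    show -(x i v) = (-1 : ℚ) • x i v
    rw [neg_one_smul]
  rw [h1]
  show PiTensorProduct.tprod ℚ (fun i => (-1 : ℚ) • x i) = _
  rw [(PiTensorProduct.tprod ℚ).map_smul_univ (fun _ => (-1 : ℚ)) x]
  rw [Finset.prod_const, Finset.card_univ, Fintype.card_fin]
  rfl

/-- **The contentful (Ind2) family genuinely moves the packets**: at the label `0` it sends the
nonzero tensor `nvUnit` to its negative. NV clause (non-identity indeterminacy). [folklore] -/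
theorem negFamily_ne_id (vQ : toyIndex.VQ) :
    negFamily 0 vQ (nvUnit 0 vQ) ≠ nvUnit 0 vQ := by
  have h := negFamily_tprod 0 vQ (fun _ => fun _ => (1 : ℚ))
  rw [show ((0 : toyIndex.Label) : ℕ) + 1 = 1 from rfl, pow_one] at h
  show negFamily 0 vQ (nvUnit 0 vQ) ≠ nvUnit 0 vQ
  rw [show negFamily 0 vQ (nvUnit 0 vQ) = (-1 : ℚ) • nvUnit 0 vQ from h]
  intro heq
  have h2 : ((-1 : ℚ) - 1) • nvUnit 0 vQ = 0 := by
    rw [sub_smul, one_smul, heq, sub_self]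
  rcases smul_eq_zero.1 h2 with h2 | h2
  · norm_num at h2
  · exact nvUnit_ne_zero 0 vQ h2

/-- The one-place sub-packets of the contentful shells are everything (the support condition over a
one-point fibre is vacuous; the pure tensors span). [folklore] -/
theorem nv_mem_subPacket (j : toyIndex.Label) (v : toyIndex.V)
    (y : nvShells.Packet j (toyIndex.over v)) : y ∈ nvShells.SubPacket j v := by
  haveI : Subsingleton toyIndex.V := inferInstanceAs (Subsingleton Unit)
  have hle : Submodule.span ℚ
      (Set.range (PiTensorProduct.tprod ℚ) : Set (nvShells.Packet j (toyIndex.over v))) ≤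
      nvShells.SubPacket j v := by
    refine Submodule.span_le.2 ?_
    rintro t ⟨x, rfl⟩
    exact Submodule.subset_span ⟨x, fun w hw => absurd (Subsingleton.elim w.1 v) hw, rfl⟩
  have h2 : Submodule.span ℚ
      (Set.range (PiTensorProduct.tprod ℚ) : Set (nvShells.Packet j (toyIndex.over v))) = ⊤ :=
    PiTensorProduct.span_tprod_eq_top
  exact hle (h2.symm ▸ Submodule.mem_top)

/-! ## 2. The comparison map and the Haar-read data over the contentful shells -/

open scoped Classical in
/-- The comparison map from a contentful packet to part A's `ZMod 4` Haar container (`0 ↦ 0`,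
everything else to `2` — as `eMap`, over the contentful shells). [folklore] -/
def nvMap (j : toyIndex.Label) (vQ : toyIndex.VQ) (x : nvShells.Packet j vQ) : ZMod 4 :=
  if x = 0 then 0 else 2

open scoped Classical in
/-- `nvMap` intertwines EVERY `ℚ`-linear indeterminacy with the identity of the container (linear
equivalences fix `0` and nonzero-ness) — in particular the genuinely non-identity `negFamily`.
[folklore] -/
theorem nvMap_comp_linearEquiv {j : toyIndex.Label} {vQ : toyIndex.VQ}
    (Φ : nvShells.Packet j vQ ≃ₗ[ℚ] nvShells.Packet j vQ) (x : nvShells.Packet j vQ) :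
    nvMap j vQ (Φ x) = nvMap j vQ x := by
  unfold nvMap
  exact if_congr (LinearEquiv.map_eq_zero_iff Φ) rfl rfl

/-- The `nvMap`-image of `{0}` is `{0}`. [folklore] -/
theorem nvMap_image_zero (j : toyIndex.Label) (vQ : toyIndex.VQ) :
    nvMap j vQ '' ({0} : Set (nvShells.Packet j vQ)) = ({0} : Set (ZMod 4)) := by
  rw [Set.image_singleton]
  unfold nvMap
  rw [if_pos rfl]

/-- The `nvMap`-image of the whole packet is `{0, 2}`. [folklore] -/
theorem nvMap_image_univ (j : toyIndex.Label) (vQ : toyIndex.VQ) :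
    nvMap j vQ '' (Set.univ : Set (nvShells.Packet j vQ)) = ({0, 2} : Set (ZMod 4)) := by
  apply Set.Subset.antisymm
  · rintro _ ⟨x, -, rfl⟩
    unfold nvMap
    split_ifs
    · exact Set.mem_insert _ _
    · exact Set.mem_insert_of_mem _ rfl
  · haveI := nv_packet_nontrivial j vQ
    obtain ⟨x0, hx0⟩ := exists_ne (0 : nvShells.Packet j vQ)
    rintro z (rfl | rfl)
    · exact ⟨0, Set.mem_univ _, by unfold nvMap; rw [if_pos rfl]⟩
    · exact ⟨x0, Set.mem_univ _, by unfold nvMap; rw [if_neg hx0]⟩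

/-- A set has a nonempty `nvMap`-image iff it is nonempty. [folklore] -/
theorem nvMap_image_nonempty_iff (j : toyIndex.Label) (vQ : toyIndex.VQ)
    (A : Set (nvShells.Packet j vQ)) : (nvMap j vQ '' A).Nonempty ↔ A.Nonempty :=
  Set.image_nonempty

/-- Admissibility of the contentful data, read off the Haar container (the capstone's `hAdm`
right-hand side, verbatim). [claim: Mochizuki2012, status: disputed] -/
@[claim "Mochizuki2012" "disputed"]
def NVAdm (j : toyIndex.Label) (vQ : toyIndex.VQ) (A : Set (nvShells.Packet j vQ)) : Prop :=
  0 < Lam4.haar (nvMap j vQ '' A) ∧ Lam4.haar (nvMap j vQ '' A) < ⊤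

/-- The log-volume of the contentful data, read off the Haar container (the capstone's `hlogvol`
right-hand side, verbatim). [claim: Mochizuki2012, status: disputed] -/
def nvVol (j : toyIndex.Label) (vQ : toyIndex.VQ) (A : Set (nvShells.Packet j vQ)) : ℝ :=
  Lam4.normalizedLogVolume 1 (nvMap j vQ '' A)

/-- `NVAdm` is "nonempty". [folklore] -/
theorem nvAdm_iff_nonempty (j : toyIndex.Label) (vQ : toyIndex.VQ)
    (A : Set (nvShells.Packet j vQ)) : NVAdm j vQ A ↔ A.Nonempty := by
  constructor
  · rintro ⟨hpos, -⟩
    rw [← nvMap_image_nonempty_iff j vQ]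
    exact nonempty_of_measure_ne_zero hpos.ne'
  · intro hA
    exact Lam4_haar_pos_lt_top ((nvMap_image_nonempty_iff j vQ A).2 hA)

/-- `nvVol` is monotone on `NVAdm`-regions. [folklore] -/
theorem nvVol_mono {j : toyIndex.Label} {vQ : toyIndex.VQ}
    {A B : Set (nvShells.Packet j vQ)} (hA : NVAdm j vQ A) (hB : NVAdm j vQ B) (hAB : A ⊆ B) :
    nvVol j vQ A ≤ nvVol j vQ B :=
  Lam4.normalizedLogVolume_mono 1 hA.1 hB.2 (Set.image_mono hAB)

/-- The Θ-side value: `nvVol {0} = log(1/4)`. [folklore] -/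
theorem nvVol_zero (j : toyIndex.Label) (vQ : toyIndex.VQ) :
    nvVol j vQ ({0} : Set (nvShells.Packet j vQ)) = Real.log 4⁻¹ := by
  unfold nvVol IntegralStructure.normalizedLogVolume IntegralStructure.logVolume
  rw [nvMap_image_zero, Lam4_haar_singleton, Nat.cast_one, div_one, ENNReal.toReal_inv]
  norm_num

/-- The `q`-side value: `nvVol univ = log(1/2)`. [folklore] -/
theorem nvVol_univ (j : toyIndex.Label) (vQ : toyIndex.VQ) :
    nvVol j vQ (Set.univ : Set (nvShells.Packet j vQ)) = Real.log 2⁻¹ := by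
  unfold nvVol IntegralStructure.normalizedLogVolume IntegralStructure.logVolume
  rw [nvMap_image_univ, Lam4_haar_pair, Nat.cast_one, div_one, ENNReal.toReal_inv]
  norm_num

/-! ## 3. The contentful data, situation, column, full situation -/

/-- Data (a)(b)(c) of the contentful witness: PROPER integral structures `shellPk = {0}`;
NONEMPTY splitting monoids (the constant nonzero tensor) with the zero action; admissibility and
log-volume read off the Haar container. [claim: Mochizuki2012, status: disputed] -/
def nvData : MRData nvShells where
  shellPk := fun j vQ => ({0} : Set (nvShells.Packet j vQ))
  shellSub := fun j v => ({0} : Set (nvShells.Packet j (toyIndex.over v)))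
  Adm := NVAdm
  logvol := nvVol
  Ψ := fun v _ =>
    ({fun j : toyIndex.LabelStar => nvUnit j.1 (toyIndex.over v)} : Set (nvShells.StarPacket v))
  act := fun _ _ _ => 0
  Mmod := fun _ => ∅

/-- The splitting monoids of the contentful witness are NONEMPTY, with a NONZERO member. NV clause.
[folklore] -/
theorem nv_psi_nonempty (v : toyIndex.V) (hv : v ∈ toyIndex.Vbad) :
    ∃ x ∈ nvData.Ψ v hv, x ≠ 0 := by
  refine ⟨fun j => nvUnit j.1 (toyIndex.over v), rfl, ?_⟩
  intro h
  have h0 := congrFun h ⟨(1 : toyIndex.Label), by decide⟩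
  exact nvUnit_ne_zero _ _ h0

/-- The integral structures of the contentful witness are PROPER: nonempty (indeed admissible, of
volume `1/4`) and not the whole packet. NV clause. [folklore] -/
theorem nv_shellPk_proper (j : toyIndex.Label) (vQ : toyIndex.VQ) :
    (nvData.shellPk j vQ).Nonempty ∧ nvData.shellPk j vQ ≠ Set.univ ∧
      nvData.Adm j vQ (nvData.shellPk j vQ) := by
  refine ⟨⟨0, rfl⟩, ?_, (nvAdm_iff_nonempty j vQ _).2 ⟨0, rfl⟩⟩
  intro h
  exact nv_univ_not_subset_zero j vQ (h ▸ subset_rfl)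

/-- One Frobenioid object per label, of degree `= nvVol(univ)`, region everything. [folklore] -/
def nvDegrees (j : toyIndex.LabelStar) : GlobalDegrees nvShells j where
  ObjMOD := Unit
  Objmod := Unit
  natIso := Equiv.refl Unit
  deg := fun _ => nvVol j.1 () Set.univ
  region := fun _ _ => Set.univ

/-- The contentful situation: the same Haar-read data on every vertical line. [folklore] -/
def nvSituation : Situation toyIndex where
  L := nvShells
  D := fun _ => nvData
  G := fun _ j => nvDegrees j

/-- The contentful column: exact Kummer readings, unit images inside the PROPER `shellPk`, the
splitting monoids transported identically. [folklore] -/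
def nvColumn : Column nvShells where
  frobAdm := fun _ => NVAdm
  frobLogvol := fun _ => nvVol
  frobΨ := fun _ v hv => nvData.Ψ v hv
  frobMmod := fun _ _ => ∅
  unitImage := fun _ _ j vQ => ({0} : Set (nvShells.Packet j vQ))
  ballImage := fun _ j vQ => ({0} : Set (nvShells.Packet j vQ))
  ObjLGP := Unit
  frobObjLGP := fun _ => Unit
  kumLGP := fun _ => Equiv.refl Unit
  ObjLgp := Unit
  frobObjLgp := fun _ => Unit
  kumLgp := fun _ => Equiv.refl Unit
  thetaPilot := fun _ => ()

/-- The contentful full situation (link objects as in the Team A gap witness). [folklore] -/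
def nvFull : FullSituation toyIndex where
  toSituation := nvSituation
  col := fun _ => nvColumn
  link := gapLink

/-! ## 4. The typed Theorem 3.11 holds at the contentful witness -/

/-- (i) holds: the nonzero splitting-monoid members lie in the (full) sub-packets, the degree clause
reads `nvVol(univ)` at the one place, the classes coincide. [folklore] -/
theorem nv_partI : nvFull.PartI := by
  refine ⟨fun n v hv x hx j => ?_, fun n j J => ⟨?_, ?_, ?_⟩, fun n n' => rfl⟩
  · exact nv_mem_subPacket j.1 v (x j)
  · intro vQ
    exact (nvAdm_iff_nonempty _ vQ _).2 ⟨0, Set.mem_univ 0⟩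
  · haveI : Finite toyIndex.VQ := inferInstanceAs (Finite Unit)
    exact Set.toFinite _
  · show nvVol j.1 () Set.univ = ∑ᶠ vQ : toyIndex.VQ, nvVol j.1 vQ Set.univ
    rw [finsum_unique]
    exact congrArg (fun v => nvVol j.1 v Set.univ) (Subsingleton.elim _ _)

/-- (ii) holds, column by column: the transported data are literally the coric data, and the unit
images sit inside the proper `shellPk`. [folklore] -/
theorem nv_partII : nvFull.toLatticeSituation.PartII := by
  intro n
  refine (Column.partII_iff _ _).2 ⟨fun m j vQ A hA => ⟨hA, rfl⟩, fun _ _ _ => rfl, fun _ _ => rfl,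
    ⟨fun _ _ _ _ _ => subset_rfl, fun _ _ vQ h => absurd trivial h⟩⟩

/-- (iii) holds: the link objects are the Team A gap witness's. [folklore] -/
theorem nv_partIII : nvFull.PartIII := by
  refine ⟨gapLink.partIIIa_holds, gapLink.partIIIb_holds, ?_, ?_,
    nvFull.evalCompatUpToInd_of_multiradialCompat nv_partI.2.2⟩
  · refine gapLink.partIIIc_of_full (fun _ => rfl) fun n m => ?_
    rintro p ⟨a, rfl⟩; rfl
  · intro n m; exact Thm311.PolyIsoCalc.stabilized_full _ _

/-- **The typed Theorem 3.11 (i) ∧ (ii) ∧ (iii) HOLDS at the contentful witness.** [folklore] -/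
theorem nvFull_statement : nvFull.Statement := ⟨nv_partI, nv_partII, nv_partIII⟩

end CapstoneWitness

end Cor312Vol

end IUTFork

end Summit.ABC

end
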